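import Literature.Analysis.FluidPDE.SawtoothCascade
import HarnessLib

/-!
# The pulse-pair gradient envelope `‖B(γ)‖` and the localised closure window of the sawtooth cascade on `γ ∈ [5, 8]` (proved)

Theorems only (no definitions, no named facts, no axioms).

**The envelope.** For the exact pulse pair of the rounded-sawtooth cascade (`SawtoothCascade`, Part 7) the scalar
gradients are transported by the unimodular matrices `A(r,s) = pulseJac γ r s = [[1 + r s γ², r γ], [s γ, 1]]`,
`r, s = ±1` (Elgindi–Liss–Mattingly's `A₁…A₄` with `α = γ`).  Part 7 proves the LOWER, itinerary-uniform growth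
`≥ γ² − 3` per pair on the unstable cone (`itinJac_growth_two`).  Here the complementary UPPER envelope is proved:
with `‖B(γ)‖ := ((γ² + 2) + √((γ² + 2)² − 4))/2` — the largest eigenvalue of the symmetric pair `A(r,r)`
(characteristic polynomial `λ² − (γ² + 2)λ + 1`; `envelope_sq`, `pulseJac_mulVec_envelope` = the eigenvector
`(‖B‖ − 1, rγ)`, so the constant is attained) — one has the Rayleigh bound `⟪v, A(r,r)v⟫ ≤ ‖B(γ)‖ ‖v‖²`
(`pulseJac_quadForm_le_envelope`) and, for ALL four sign pairs, the Euclidean operator bound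
`‖A(r,s)v‖² ≤ ‖B(γ)‖² ‖v‖²` (`pulseJac_euclidSq_le_envelope_sq`; for `r ≠ s` the top singular value
`((γ⁴+2)+√((γ⁴+2)²−4))/2 ≤ ‖B(γ)‖²` is absorbed by the identity `‖B‖⁴ + 1 = ((γ²+2)² − 2)‖B‖²`), together with
`1 + γ² ≤ ‖B(γ)‖ < γ² + 2` (`one_add_sq_le_envelope`, `envelope_lt`).  In the expression everything is spelled
out (no definition is introduced): `((γ ^ 2 + 2) + Real.sqrt ((γ ^ 2 + 2) ^ 2 - 4)) / 2`.

**The window** (cell `ad-ideate`, seat ad-p2, route `SawtoothPulseCascade` rev 8, support item `ClosureMargin58` =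
stub S0 of the registered line `Cruxes.K3LocalisedClosure.Loc58`, verbatim): for every `γ ∈ [5, 8]`,
`3 · e^{σ⋆ γ} · ‖B(γ)‖ < (γ² − 3)²` (`closureMargin58`), where `σ⋆ = sawSigmaStar = 0.30982` is the certified
maximal Kelvin–Helmholtz rate per unit strain of the triangle-wave shear (`sawSigma_le_sawSigmaStar`, Part 5; the
per-phase cap of `K2PhaseGrowth` is `3e^{σ⋆γ}`) and `γ² − 3` the certified per-pair growth floor (Part 7): the cost
series of the localised closure is geometric in `3e^{σ⋆γ}‖B(γ)‖/(γ² − 3)²`.  We prove the QUANTITATIVE form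
`3 e^{σ⋆γ} ‖B(γ)‖ ≤ (4/5)(γ² − 3)²` on `[5, 8]` (`closureMargin58_le`; float sup of the ratio `0.7867` at `γ = 5`),
from which the item follows.  Certificate: `‖B(γ)‖ < γ² + 2`; `e^{σ⋆γ}` lies below its CHORD on `[5, 8]`
(convexity, `convexOn_exp`) with end values `e^{1.5491} ≤ 4.708` and `e^{2.47856} ≤ 11.925` (`Real.exp_bound'` at
`0.77455`, squared, and at `0.61964`, fourth power); the remaining quartic-minus-cubic polynomial inequality has all
Taylor coefficients at `γ = 5` positive (`5.852 + 15.901 t + 28.906 t² + 8.783 t³ + 0.8 t⁴`, `t = γ − 5 ≥ 0`).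
WHAT THIS IS NOT: not a statement about the Navier–Stokes or transport dynamics — a numerical window and a
linear-algebra envelope used by the route's closure bookkeeping.
[cite: ElgindiLissMattingly2025, §1.2.2 (the matrices A₁–A₄ transporting scalar gradients; eigenvalues c_α, 1/c_α) and §3.1 Lemma 3.1]
[cite: Drazin2002, §8.3 Example 8.3 and Exercise 8.10 (the maximal growth rate entering σ⋆)]
[cite: BrueDeLellisCMP2023, §2 Question 2.1 (the target the window serves)] [problem: turb]
-/

open Set

namespace Literature.Analysis.FluidPDE.SawtoothCascade

noncomputable section

open scoped Matrix

/-! ## Part A — the envelope `‖B(γ)‖ = ((γ²+2) + √((γ²+2)²−4))/2` of the pulse-pair Jacobians -/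

/-- The discriminant is nonnegative: `4 ≤ (γ²+2)²`, indeed `(γ²+2)² − 4 = γ⁴ + 4γ²`. [folklore] -/
private theorem envelope_discr_eq (γ : ℝ) : (γ ^ 2 + 2) ^ 2 - 4 = γ ^ 4 + 4 * γ ^ 2 := by ring

/-- `√((γ²+2)² − 4)² = (γ²+2)² − 4`. [folklore] -/
private theorem sq_sqrt_envelope_discr (γ : ℝ) :
    Real.sqrt ((γ ^ 2 + 2) ^ 2 - 4) ^ 2 = (γ ^ 2 + 2) ^ 2 - 4 :=
  Real.sq_sqrt (by rw [envelope_discr_eq]; positivity)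

/-- `γ² ≤ √((γ²+2)² − 4)` (since `γ⁴ ≤ γ⁴ + 4γ²`). [folklore] -/
private theorem sq_le_sqrt_envelope_discr (γ : ℝ) : γ ^ 2 ≤ Real.sqrt ((γ ^ 2 + 2) ^ 2 - 4) := by
  rw [Real.le_sqrt (sq_nonneg γ) (show (0 : ℝ) ≤ (γ ^ 2 + 2) ^ 2 - 4 by rw [envelope_discr_eq]; positivity),
    envelope_discr_eq]
  nlinarith [sq_nonneg γ]

/-- `√((γ²+2)² − 4) < γ² + 2`. [folklore] -/
private theorem sqrt_envelope_discr_lt (γ : ℝ) : Real.sqrt ((γ ^ 2 + 2) ^ 2 - 4) < γ ^ 2 + 2 := by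
  rw [Real.sqrt_lt' (show (0 : ℝ) < γ ^ 2 + 2 by positivity)]
  linarith

/-- **Characteristic equation.** `‖B(γ)‖² = (γ²+2)‖B(γ)‖ − 1`: the envelope is a root of the characteristic
polynomial `λ² − tr A(r,r) λ + det A(r,r) = λ² − (γ²+2)λ + 1` of the symmetric pulse-pair Jacobian.
[cite: ElgindiLissMattingly2025, §1.2.2 (eigenvalues c_α, 1/c_α of the matrices A_i)] -/
theorem envelope_sq (γ : ℝ) :
    (((γ ^ 2 + 2) + Real.sqrt ((γ ^ 2 + 2) ^ 2 - 4)) / 2) ^ 2 =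
      (γ ^ 2 + 2) * (((γ ^ 2 + 2) + Real.sqrt ((γ ^ 2 + 2) ^ 2 - 4)) / 2) - 1 := by
  linear_combination (1 / 4 : ℝ) * sq_sqrt_envelope_discr γ

/-- `1 + γ² ≤ ‖B(γ)‖` (diagonal dominance of the top eigenvalue). [cite: ElgindiLissMattingly2025, §1.2.2 (eigenvalues c_α, 1/c_α of the matrices A_i)] -/
theorem one_add_sq_le_envelope (γ : ℝ) :
    1 + γ ^ 2 ≤ ((γ ^ 2 + 2) + Real.sqrt ((γ ^ 2 + 2) ^ 2 - 4)) / 2 := by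
  linarith [sq_le_sqrt_envelope_discr γ]

/-- `‖B(γ)‖ < γ² + 2` (`= tr A(r,r)`; the other eigenvalue `1/‖B‖` is positive). [cite: ElgindiLissMattingly2025, §1.2.2 (eigenvalues c_α, 1/c_α of the matrices A_i)] -/
theorem envelope_lt (γ : ℝ) :
    ((γ ^ 2 + 2) + Real.sqrt ((γ ^ 2 + 2) ^ 2 - 4)) / 2 < γ ^ 2 + 2 := by
  linarith [sqrt_envelope_discr_lt γ]

/-- `0 < ‖B(γ)‖`. [cite: ElgindiLissMattingly2025, §1.2.2 (eigenvalues c_α, 1/c_α of the matrices A_i)] -/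
theorem envelope_pos (γ : ℝ) : 0 < ((γ ^ 2 + 2) + Real.sqrt ((γ ^ 2 + 2) ^ 2 - 4)) / 2 := by
  linarith [one_add_sq_le_envelope γ, sq_nonneg γ]

/-- `‖B(γ)‖⁴ + 1 = ((γ²+2)² − 2) ‖B(γ)‖²` — i.e. `‖B‖² + ‖B‖⁻² = tr(A(r,r)²) = (γ²+2)² − 2`; this is what places the
top singular value of the non-symmetric pairs `A(r,−r)` (trace of `AᵀA` equal to `γ⁴ + 2 ≤ (γ²+2)² − 2`) below
`‖B(γ)‖²`. [cite: ElgindiLissMattingly2025, §1.2.2 (eigenvalues c_α, 1/c_α of the matrices A_i)] -/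
theorem envelope_pow_four_add_one (γ : ℝ) :
    (((γ ^ 2 + 2) + Real.sqrt ((γ ^ 2 + 2) ^ 2 - 4)) / 2) ^ 4 + 1 =
      ((γ ^ 2 + 2) ^ 2 - 2) * (((γ ^ 2 + 2) + Real.sqrt ((γ ^ 2 + 2) ^ 2 - 4)) / 2) ^ 2 := by
  have h := envelope_sq γ
  set E := ((γ ^ 2 + 2) + Real.sqrt ((γ ^ 2 + 2) ^ 2 - 4)) / 2
  linear_combination (E ^ 2 + (γ ^ 2 + 2) * E + 1) * h

/-- **The envelope is attained**: `(‖B(γ)‖ − 1, rγ)` is an eigenvector of the symmetric pulse-pair Jacobian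
`A(r,r) = [[1+γ², rγ],[rγ, 1]]` with eigenvalue `‖B(γ)‖` (`r = ±1`).
[cite: ElgindiLissMattingly2025, §1.2.2 (eigenvalues c_α, 1/c_α of A₁, A₄)] -/
theorem pulseJac_mulVec_envelope {γ r : ℝ} (hr : r = 1 ∨ r = -1) :
    pulseJac γ r r *ᵥ ![((γ ^ 2 + 2) + Real.sqrt ((γ ^ 2 + 2) ^ 2 - 4)) / 2 - 1, r * γ] =
      (((γ ^ 2 + 2) + Real.sqrt ((γ ^ 2 + 2) ^ 2 - 4)) / 2) •
        ![((γ ^ 2 + 2) + Real.sqrt ((γ ^ 2 + 2) ^ 2 - 4)) / 2 - 1, r * γ] := by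
  have h := envelope_sq γ
  have hr2 : r * r = 1 := by rcases hr with rfl | rfl <;> norm_num
  set E := ((γ ^ 2 + 2) + Real.sqrt ((γ ^ 2 + 2) ^ 2 - 4)) / 2
  rw [pulseJac_mulVec]
  ext i; fin_cases i
  · simp
    linear_combination (-1 : ℝ) * h + (γ ^ 2 * (E - 1) + γ ^ 2) * hr2
  · simp
    ring

/-- **Rayleigh bound** for the symmetric pulse-pair Jacobians `A(r,r)`, `r = ±1`:
`⟪v, A(r,r) v⟫ = x((1+γ²)x + rγy) + y(rγx + y) ≤ ‖B(γ)‖ (x² + y²)` for all `(x,y)`.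
(`(‖B‖−1)·(‖B‖‖v‖² − ⟪v,Av⟫) = (γx − r(‖B‖−1)y)²`, using `(‖B‖ − 1 − γ²)(‖B‖ − 1) = γ²`.)
[cite: ElgindiLissMattingly2025, §1.2.2 (A₁, A₄) and §3.1] -/
theorem pulseJac_quadForm_le_envelope {γ r : ℝ} (hγ : 0 < γ) (hr : r = 1 ∨ r = -1) (x y : ℝ) :
    x * ((1 + r * r * γ ^ 2) * x + r * γ * y) + y * (r * γ * x + y) ≤
      ((γ ^ 2 + 2) + Real.sqrt ((γ ^ 2 + 2) ^ 2 - 4)) / 2 * (x ^ 2 + y ^ 2) := by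
  have h := envelope_sq γ
  have h1 := one_add_sq_le_envelope γ
  have hr2 : r * r = 1 := by rcases hr with rfl | rfl <;> norm_num
  have hγ2 := pow_pos hγ 2
  set E := ((γ ^ 2 + 2) + Real.sqrt ((γ ^ 2 + 2) ^ 2 - 4)) / 2
  have hd : 0 < E - 1 := by linarith
  have hkey : (E - 1) * (E * (x ^ 2 + y ^ 2) - (x * ((1 + r * r * γ ^ 2) * x + r * γ * y) + y * (r * γ * x + y))) =
      (γ * x - r * (E - 1) * y) ^ 2 := by
    linear_combination x ^ 2 * h + (-(x ^ 2 * γ ^ 2 * (E - 1) + y ^ 2 * (E - 1) ^ 2)) * hr2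
  have hq : 0 ≤ E * (x ^ 2 + y ^ 2) - (x * ((1 + r * r * γ ^ 2) * x + r * γ * y) + y * (r * γ * x + y)) :=
    le_of_mul_le_mul_left (by rw [mul_zero, hkey]; positivity) hd
  linarith

/-- **Euclidean operator bound for all four pulse-pair Jacobians**: for `r, s = ±1` and every `(x, y)`,
`‖A(r,s)(x,y)‖² = ((1 + rsγ²)x + rγy)² + (sγx + y)² ≤ ‖B(γ)‖² (x² + y²)`.  For `s = r` this is the square of the
Rayleigh bound (Cayley–Hamilton `A² = (γ²+2)A − 1`); for `s = −r` the Gram matrix `AᵀA = [[γ⁴−γ²+1, −rγ³],[−rγ³, γ²+1]]`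
has `‖B‖² − AᵀA` positive semidefinite with determinant `4γ²‖B‖²` (`envelope_pow_four_add_one`).  Complements the
lower cone growth `≥ (γ²/2)²` of `pulseJac_euclidSq_growth_two`.
[cite: ElgindiLissMattingly2025, §1.2.2 (A₁–A₄) and §3.1 Lemma 3.1] -/
theorem pulseJac_euclidSq_le_envelope_sq {γ r s : ℝ} (hγ : 0 < γ) (hr : r = 1 ∨ r = -1) (hs : s = 1 ∨ s = -1)
    (x y : ℝ) :
    ((1 + r * s * γ ^ 2) * x + r * γ * y) ^ 2 + (s * γ * x + y) ^ 2 ≤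
      (((γ ^ 2 + 2) + Real.sqrt ((γ ^ 2 + 2) ^ 2 - 4)) / 2) ^ 2 * (x ^ 2 + y ^ 2) := by
  have h := envelope_sq γ
  have h1 := one_add_sq_le_envelope γ
  have h4 := envelope_pow_four_add_one γ
  have hq0 := pulseJac_quadForm_le_envelope hγ hr x y
  have hr2 : r * r = 1 := by rcases hr with rfl | rfl <;> norm_num
  -- either `s = r` or `s = -r`
  have hrs : r = s ∨ -r = s := by
    rcases hr with rfl | rfl <;> rcases hs with rfl | rfl <;> norm_num
  set E := ((γ ^ 2 + 2) + Real.sqrt ((γ ^ 2 + 2) ^ 2 - 4)) / 2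
  have hE0 : 0 ≤ E := by linarith [sq_nonneg γ]
  rcases hrs with rfl | rfl
  · -- symmetric pair: ‖Av‖² = (γ²+2)⟪v,Av⟫ − ‖v‖² ≤ ((γ²+2)‖B‖ − 1)‖v‖² = ‖B‖²‖v‖² (Cayley–Hamilton)
    have hCH : ((1 + r * r * γ ^ 2) * x + r * γ * y) ^ 2 + (r * γ * x + y) ^ 2 =
        (γ ^ 2 + 2) * (x * ((1 + r * r * γ ^ 2) * x + r * γ * y) + y * (r * γ * x + y)) - (x ^ 2 + y ^ 2) := by
      linear_combination ((γ ^ 2 + r * r * γ ^ 4) * x ^ 2 + 2 * r * γ ^ 3 * x * y + γ ^ 2 * y ^ 2) * hr2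
    rw [hCH]
    have ha : (0 : ℝ) ≤ γ ^ 2 + 2 := by positivity
    have hmul := mul_le_mul_of_nonneg_left hq0 ha
    have h' : E ^ 2 * (x ^ 2 + y ^ 2) = ((γ ^ 2 + 2) * E - 1) * (x ^ 2 + y ^ 2) := by rw [h]
    linarith
  · -- antisymmetric signs: the Gram matrix `AᵀA = [[γ⁴−γ²+1, −rγ³],[−rγ³, γ²+1]]` lies below `‖B‖²`
    have hsq : (1 + γ ^ 2) * (1 + γ ^ 2) ≤ E * E := mul_le_mul h1 h1 (by positivity) hE0
    have hδ : 0 < E ^ 2 - γ ^ 2 - 1 := by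
      have : 0 < γ ^ 4 + γ ^ 2 := by positivity
      nlinarith
    -- δ·Q = (β x + δ y)² + (αδ − β²) x² with α = ‖B‖² − γ⁴ + γ² − 1, β = rγ³, δ = ‖B‖² − γ² − 1, αδ − β² = 4γ²‖B‖²
    have hdet : (E ^ 2 - γ ^ 4 + γ ^ 2 - 1) * (E ^ 2 - γ ^ 2 - 1) - (r * γ ^ 3) ^ 2 = 4 * γ ^ 2 * E ^ 2 := by
      linear_combination h4 + (-(γ ^ 6)) * hr2
    have hexp : ((1 + r * -r * γ ^ 2) * x + r * γ * y) ^ 2 + (-r * γ * x + y) ^ 2 =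
        (γ ^ 4 - γ ^ 2 + 1) * x ^ 2 - 2 * (r * γ ^ 3) * (x * y) + (γ ^ 2 + 1) * y ^ 2 := by
      linear_combination ((γ ^ 4 * (r * r + 1) - γ ^ 2) * x ^ 2 - 2 * r * γ ^ 3 * x * y + γ ^ 2 * y ^ 2) * hr2
    rw [hexp]
    have hkey : (E ^ 2 - γ ^ 2 - 1) *
        (E ^ 2 * (x ^ 2 + y ^ 2) - ((γ ^ 4 - γ ^ 2 + 1) * x ^ 2 - 2 * (r * γ ^ 3) * (x * y) + (γ ^ 2 + 1) * y ^ 2)) =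
        (r * γ ^ 3 * x + (E ^ 2 - γ ^ 2 - 1) * y) ^ 2 +
          ((E ^ 2 - γ ^ 4 + γ ^ 2 - 1) * (E ^ 2 - γ ^ 2 - 1) - (r * γ ^ 3) ^ 2) * x ^ 2 := by
      ring
    rw [hdet] at hkey
    have hq : 0 ≤ E ^ 2 * (x ^ 2 + y ^ 2) -
        ((γ ^ 4 - γ ^ 2 + 1) * x ^ 2 - 2 * (r * γ ^ 3) * (x * y) + (γ ^ 2 + 1) * y ^ 2) :=
      le_of_mul_le_mul_left (by rw [mul_zero, hkey]; positivity) hδ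
    linarith

/-- Matrix form of the operator bound: `‖A(r,s) v‖² ≤ ‖B(γ)‖² ‖v‖²` in the coordinates of `pulseJac_mulVec`
(sum of squares of the two entries). [cite: ElgindiLissMattingly2025, §1.2.2 (A₁–A₄)] -/
theorem pulseJac_mulVec_sq_add_sq_le {γ r s : ℝ} (hγ : 0 < γ) (hr : r = 1 ∨ r = -1) (hs : s = 1 ∨ s = -1)
    (v : Fin 2 → ℝ) :
    (pulseJac γ r s *ᵥ v) 0 ^ 2 + (pulseJac γ r s *ᵥ v) 1 ^ 2 ≤
      (((γ ^ 2 + 2) + Real.sqrt ((γ ^ 2 + 2) ^ 2 - 4)) / 2) ^ 2 * (v 0 ^ 2 + v 1 ^ 2) := by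
  rw [pulseJac_mulVec]
  simpa using pulseJac_euclidSq_le_envelope_sq hγ hr hs (v 0) (v 1)

/-! ## Part B — the localised closure window on the box `γ ∈ [5, 8]` (ad-p2's `ClosureMargin58`) -/

/-- Numeric: `e^{5σ⋆} = e^{1.5491} ≤ 4.708` (`Real.exp_bound'` at `0.77455 = 1.5491/2`, `n = 6`, squared). [folklore] -/
private theorem exp_sawSigmaStar_mul_five_le : Real.exp (sawSigmaStar * 5) ≤ 4708 / 1000 := by
  have h := Real.exp_bound' (x := (15491 / 20000 : ℝ)) (by norm_num) (by norm_num) (n := 6) (by norm_num)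
  simp only [Finset.sum_range_succ, Finset.sum_range_zero, Nat.factorial] at h
  norm_num at h
  have h2 : Real.exp (sawSigmaStar * 5) = Real.exp (15491 / 20000 : ℝ) ^ 2 := by
    rw [← Real.exp_nat_mul]; norm_num [sawSigmaStar]
  rw [h2]
  have hpos : 0 ≤ Real.exp (15491 / 20000 : ℝ) := (Real.exp_pos _).le
  calc Real.exp (15491 / 20000 : ℝ) ^ 2 ≤ _ ^ 2 := pow_le_pow_left₀ hpos h 2
    _ ≤ _ := by norm_num

/-- Numeric: `e^{8σ⋆} = e^{2.47856} ≤ 11.925` (`Real.exp_bound'` at `0.61964 = 2.47856/4`, `n = 6`, fourth power).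
[folklore] -/
private theorem exp_sawSigmaStar_mul_eight_le : Real.exp (sawSigmaStar * 8) ≤ 11925 / 1000 := by
  have h := Real.exp_bound' (x := (15491 / 25000 : ℝ)) (by norm_num) (by norm_num) (n := 6) (by norm_num)
  simp only [Finset.sum_range_succ, Finset.sum_range_zero, Nat.factorial] at h
  norm_num at h
  have h4 : Real.exp (sawSigmaStar * 8) = Real.exp (15491 / 25000 : ℝ) ^ 4 := by
    rw [← Real.exp_nat_mul]; norm_num [sawSigmaStar]
  rw [h4]
  have hpos : 0 ≤ Real.exp (15491 / 25000 : ℝ) := (Real.exp_pos _).le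
  calc Real.exp (15491 / 25000 : ℝ) ^ 4 ≤ _ ^ 4 := pow_le_pow_left₀ hpos h 4
    _ ≤ _ := by norm_num

/-- **Chord bound**: on `[5, 8]`, `e^{σ⋆γ} ≤ ((8 − γ)·4.708 + (γ − 5)·11.925)/3` (convexity of `exp` and the two
end-point bounds). [folklore] -/
private theorem exp_sawSigmaStar_mul_le_chord {γ : ℝ} (hγ : γ ∈ Icc (5 : ℝ) 8) :
    Real.exp (sawSigmaStar * γ) ≤ ((8 - γ) * (4708 / 1000) + (γ - 5) * (11925 / 1000)) / 3 := by
  obtain ⟨h5, h8⟩ := hγ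
  have ha : 0 ≤ (8 - γ) / 3 := by linarith
  have hb : 0 ≤ (γ - 5) / 3 := by linarith
  have hconv := convexOn_exp.2 (mem_univ (sawSigmaStar * 5)) (mem_univ (sawSigmaStar * 8)) ha hb (by ring)
  simp only [smul_eq_mul] at hconv
  have harg : (8 - γ) / 3 * (sawSigmaStar * 5) + (γ - 5) / 3 * (sawSigmaStar * 8) = sawSigmaStar * γ := by ring
  rw [harg] at hconv
  have e5 := mul_le_mul_of_nonneg_left exp_sawSigmaStar_mul_five_le ha
  have e8 := mul_le_mul_of_nonneg_left exp_sawSigmaStar_mul_eight_le hb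
  linarith

/-- **The window, quantitative form**: for every `γ ∈ [5, 8]`,
`3 · e^{σ⋆γ} · ‖B(γ)‖ ≤ (4/5) · (γ² − 3)²` — a UNIFORM contraction ratio `≤ 4/5` for the cost series of the
localised closure (float sup of the ratio `0.7867` at `γ = 5`).
[cite: BrueDeLellisCMP2023, §2 Question 2.1 (the target the window serves)]
[cite: ElgindiLissMattingly2025, §3.1 Lemma 3.1 (the per-pair growth the window is measured against)] -/
theorem closureMargin58_le {γ : ℝ} (hγ : γ ∈ Icc (5 : ℝ) 8) :
    3 * Real.exp (sawSigmaStar * γ) * (((γ ^ 2 + 2) + Real.sqrt ((γ ^ 2 + 2) ^ 2 - 4)) / 2) ≤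
      4 / 5 * (γ ^ 2 - 3) ^ 2 := by
  have hch := exp_sawSigmaStar_mul_le_chord hγ
  obtain ⟨h5, h8⟩ := hγ
  have hE := (envelope_lt γ).le
  have hEpos := (envelope_pos γ).le
  have hexp : 0 ≤ Real.exp (sawSigmaStar * γ) := (Real.exp_pos _).le
  -- 3 e^{σ⋆γ} ‖B‖ ≤ 3 · chord · (γ² + 2)
  have hchord : 0 ≤ ((8 - γ) * (4708 / 1000) + (γ - 5) * (11925 / 1000)) / 3 := by
    have : 0 ≤ 8 - γ := by linarith
    have : 0 ≤ γ - 5 := by linarith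
    positivity
  have h1 : 3 * Real.exp (sawSigmaStar * γ) * (((γ ^ 2 + 2) + Real.sqrt ((γ ^ 2 + 2) ^ 2 - 4)) / 2) ≤
      3 * (((8 - γ) * (4708 / 1000) + (γ - 5) * (11925 / 1000)) / 3) * (γ ^ 2 + 2) := by
    have := mul_le_mul hch hE hEpos hchord
    linarith
  -- the polynomial inequality: all Taylor coefficients at γ = 5 are positive
  have ht : 0 ≤ γ - 5 := by linarith
  have hpoly : 3 * (((8 - γ) * (4708 / 1000) + (γ - 5) * (11925 / 1000)) / 3) * (γ ^ 2 + 2) ≤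
      4 / 5 * (γ ^ 2 - 3) ^ 2 := by
    nlinarith [mul_nonneg ht ht, mul_nonneg (mul_nonneg ht ht) ht, mul_nonneg (mul_nonneg ht ht) (mul_nonneg ht ht)]
  exact h1.trans hpoly

/-- **ad-p2's `ClosureMargin58`, verbatim** (route `SawtoothPulseCascade`, support item; stub S0 of the line
`Cruxes.K3LocalisedClosure.Loc58`): for every `γ ∈ [5, 8]`, `3 · e^{σ⋆ γ} · ‖B(γ)‖ < (γ² − 3)²`.
[cite: BrueDeLellisCMP2023, §2 Question 2.1 (the target the window serves)]
[cite: Drazin2002, §8.3 Example 8.3 and Exercise 8.10 (σ⋆)] -/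
theorem closureMargin58 :
    ∀ γ ∈ Set.Icc (5 : ℝ) 8, 3 * Real.exp (sawSigmaStar * γ) *
      (((γ ^ 2 + 2) + Real.sqrt ((γ ^ 2 + 2) ^ 2 - 4)) / 2) < (γ ^ 2 - 3) ^ 2 := by
  intro γ hγ
  have h := closureMargin58_le hγ
  have hpos : 0 < (γ ^ 2 - 3) ^ 2 := by
    have : 0 < γ ^ 2 - 3 := by nlinarith [hγ.1]
    positivity
  linarith

/-- Ratio form of the window: `3 e^{σ⋆γ} ‖B(γ)‖ / (γ² − 3)² ≤ 4/5 < 1` on `[5, 8]` (the geometric ratio of the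
closure's cost series). [cite: BrueDeLellisCMP2023, §2 Question 2.1] -/
theorem closureMargin58_ratio_le {γ : ℝ} (hγ : γ ∈ Icc (5 : ℝ) 8) :
    3 * Real.exp (sawSigmaStar * γ) * (((γ ^ 2 + 2) + Real.sqrt ((γ ^ 2 + 2) ^ 2 - 4)) / 2) /
      (γ ^ 2 - 3) ^ 2 ≤ 4 / 5 := by
  have hpos : 0 < (γ ^ 2 - 3) ^ 2 := by
    have : 0 < γ ^ 2 - 3 := by nlinarith [hγ.1]
    positivity
  rw [div_le_iff₀ hpos]
  exact closureMargin58_le hγ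

end

end Literature.Analysis.FluidPDE.SawtoothCascade
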